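import Summits.BirchSwinnertonDyer.Rank1Residual.Additive.X4ThreeKuriharaEndM2RowShapes2
import Summits.BirchSwinnertonDyer.Rank1Residual.GaloisImage.KuriharaRecordBSDpThreeLevelTwoEndNoEP
import HarnessLib

/-!
# THE END-m2 PILOT RECORD: `BSD(E,3)` for `17640ce1` (class A2, `#E(ℚ₃)[3] = 3`) at the depth-two
# level `163·1567 = 255421` from ONE Kurihara non-vanishing `3·δ̃_n ≠ 0` in `ℤ/9` (a UNIT mod `3`), two
# level-zero values and ONE port — no [S24] fact, no analytic-rank binder, no sub-level vanishing, no
# parity; filed on the census REGISTER WORD (quoted verbatim below)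
# (cell `b2b-bsdres`, team n1011, ROUTE-1 §35.6 / §36 R1-61; row T-E2-REC PILOT; lead R5-88 (a) /
# R5-90 (a); seat p18 — text banked by p18 GEN 7 (`HOME/b2b-bsdres-n1011-p18/g7/pilot-draft/…v3.lean`,
# rc 0), filed by p18 GEN 10 on the word)

HONEST FRAMING (cell `b2b-bsdres`, run/shared/lean/b2b/bsd-rank1-residual/, verbatim in every
file): the goal of the cell is to DELETE the COMBINATION-SHAPED residual classes of the
Birch–Swinnerton-Dyer formula for ALL analytic-rank `≤ 1` elliptic curves over `ℚ` — "full BSD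
formula for every rank `≤ 1` curve in class `C`" assembled STRICTLY from published theorems — so
that the rank-`≤ 1` remainder becomes exactly the CONSTRUCTION-SHAPED classes, which are TYPED
(missing-input `Prop`s), NOT attempted. This is not "finishing BSD". Team n1011 (N10/N11, the
additive block `X4 ∧ p = 3`): research route; no claim beyond the stated classes; the label X4 and
the mark of RESIDUAL-MAP §I N11 are UNCHANGED by this file; nothing is booked; no census count moves.
This is a PER-PAIR RECORD SHAPE (certificate-evidence), NOT a class theorem; theorems only (no
definition, no named fact minted).

## The census REGISTER WORD this record is filed on (VERBATIM, with its locator)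

**'TWO-SOURCE UNIT at (17640ce1, n = 255 421 = 163·1567)'** — census-lead GEN 16, pass 2,
2026-08-22T01:05:39Z, `run/shared/lean/ttrl/requests.jsonl` l.2229 (name
`census-lead-g16-pass2-A243-G1-E2AT3-cal2-j143220-CONTROLS-FIRST-VALID-TWO-SOURCE-UNIT-17640ce1-n255421-WORD-WRITTEN`,
CELL-PLAN v1.202 A-243, GATES G-1) = `HOME/INBOX.md` l.8312; register pointer
`cells/n1011/PREDICTIONS-E2-AT3.md` A41 (1)(a) l.95 (pre-registrations A27 l.80 / A39 l.92 BEFORE the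
ids — ORDER ✓ — results pointers A26 l.79 / A40 l.94); lead n1011 R5-88 (a) / R5-90 (a)
(`cells/n1011/PLAN.md` l.304 / l.310).  TIER LABEL (lead R5-90 (a), verbatim): 'EVIDENCE /
certificate-shaped, two method- and input-disjoint SOURCES (engine 2 = PARI-family j136181 · ENG-D e1 =
point-counting j143220) — not a two-engine reading of one implementation; never a Literature fact;
p = 3 modulo [K25] PREPRINT'.  The two SOURCES of the ONE value used (`δ̃_{255421} ≢ 0 (mod 3)`):
* source 1 — n1011-p08 ENGINE 2 v1.7 (PARI family, `ENDM2-D2-15`), kit **j136181** (register A26;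
  census GEN 14 pass 9: controls 3/3 IDENTICAL ⇒ VALID): `HOME/b2b-bsdres-n1011-p08/e2at3/out/j136181/ENDM2-TABLE.md`
  (sha16 `2a2115a6fc9a462d`) row `17640ce1 | 17640 | 255421 | 163 | 1567 | a = 2, 56 | cyc 1/1 | k_n = 3 |
  δ̃ ≡ 26 (mod 27) | δ̃ mod 3 = 2 | UNIT at a both-cyclic depth-2 level`;
* source 2 — ENG-D e1 `cc3_msadd 0.4.1-goodlevel` / `ellan_lean 1.0` (PARI-free, `a_n` by point
  counting; cc-eng-3's g11 bundle pressed UNCHANGED by n1011-p08), kit **j143220** (register A40;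
  CONTROLS FIRST: e1 = EXACT of record j129014 on 12/12 control levels of 37a1 / 5077a1, κ = 1,
  x0 3/3 ⇒ VALID; certificate ok 3/3, Hecke 3 942/0, maxdev < 10⁻⁶):
  `HOME/b2b-bsdres-n1011-p08/e2at3/out/j143220/KFOLD.tsv` (sha16 `36ffd23ff6b2a7f9`) row
  `17640ce1 | 163*1567 | 255421 | a = 2, 56 | S = −703 494 964 | k_max 3 | δ̃ ≡ 2 (mod 3), 8 (mod 9),
  26 (mod 27) | UNIT | H0 ✓ | x0 = 36 | c_∞ = 2`; the singles `163`, `1567` read `δ̃ ≡ 0` = NO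
  INFORMATION (never evidence); mod-`27` residues coincide (`26 = 26`), reported not graded.
The two level-zero values (`3·δ̃_1 = 0` in `ℤ/9`, `δ̃_1 ≢ 0 (mod 27)`, i.e. `ord₃ [0]⁺ = 2`):
source 1 = n1011-p08 E2-AT3 STAGE 2, kit j128824, `STAGE2-TABLE.md` row 58 (`17640ce1 | UNIT | (M) |
v = 2 | ord₃ #Ш_an = 2 | d0 = 2 | t = 1`); source 2 = Cremona's table / ecdata as carried in p08's
`curves_stage2v2.tsv` l.61 (rank `0`, `#E(ℚ)_tors = 2`, `∏ c_ℓ = 8`, `#Ш_an = 9` ⟹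
`ord₃ (L(E,1)/Ω) = ord₃ (9·8/2²) = 2`).
KURX / ENGINE CONSUMPTION CONDITIONS (ttrl3 S0-KUR (iii) relay (a)–(e), n1011 R5-37 (b) / R5-43 (f) /
R5-80 (l), riding VERBATIM as ruled): (a) = (n1) '(iii): P1 0/242; P2 87.2 % FAIL as registered
(90 %); follow-up 94.7 % (FOLLOW-UP)'; (b) yield expectations = the pre-registered reach statement
(A27), not the 90 % figure; (c) (n3) candidate-rule / engine version stamped before the first id
(A27 l.80, A38 l.91, A39 l.92: engine strings `v1.7` / `cc3_msadd 0.4.1-goodlevel`); (d) = (n5)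
'zeros in ℤ_p/I_n are never evidence; out-of-reach / undecided rows always counted and listed' — here:
ONE (row, n) asked and decided informative by BOTH sources; the two singles `163`, `1567` and engine
2's level `163·4159 = 677917` (`δ̃ ≡ 9 (mod 27)`) are ZEROS, listed, never evidence; `0`
out-of-reach, `0` undecided; engine 2's third level `163·11719` (UNIT, `δ̃ ≡ 10 (mod 27)`) is
SINGLE-SOURCE and NOT used; (e) C-IMG control: none applicable (`ρ̄_{E,3}` SURJECTIVE and the whole
`3`-adic tower onto, certified IN THE KERNEL by `towerSurj3_v17640ce1`).
EVERYTHING UNPROVED IS A DISPLAYED `(h : …)` BINDER: the UPPER-half named facts of the X4 chain of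
record (`hKatoS hDel hmodD hKatoχ`, with `hGZK hmod`), MANIN (`h26` — Cremona's `|c| = 1` for
`N ≤ 130000` as a named fact; the optimal datum `D`, `hopt` displayed), Cassels–Tate (`hCT`), the
Poitou–Tate family at `3` (`inv hperf hsum hcompl`, or the ONE named fact `hPT`), Tate's local
Euler–Poincaré characteristic (`hEP` — or NONE in the `_noEP` form, where it is n1011-p04's THEOREM
p300886), the ONE port `hPort : KatoKuriharaPortThreeAt W 1 v₃` (FLAG `K22-Thm3.13-PORT@3`:
Kim's Thm. 3.13 dictionary at `p = 3`, construction-shaped, NOT in print at `3` — this is the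
'p = 3' clause of the tier label on the END-m2 forms), in §2 the ANNOUNCED [K25] Thm. 1.1 clause
`hK25s` (FLAG `Kim2025-preprint` — the 'p = 3 modulo [K25] PREPRINT' clause of the label on the
[K25]-currency form) with `hr`, and on every form THE UNIT READING ITSELF, `hδ`, as a displayed
certificate datum (`∃ ψ onto, …`; independent of `ψ` up to a unit).  NO [S24] fact (injectivity at
the core vertex by base rigidity, n1011-p15 F-E1/F-E2 over n1011-p11 R1-58); NO `hr` on the END-m2
forms (read off the level-zero value).  Whether the census REGISTER marks this `(row, n)` is the
census cell's word, quoted above, not this file's; census-lead checks this landing against the word.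

## What this file does

`17640ce1` (`N = 17640 = 2³·3²·5·7²`; Cremona's minimal model `[0, 0, 0, -1242003, -532681058]`;
ADDITIVE at `3` of Kodaira type `I₅*` — potentially MULTIPLICATIVE (`ord₃ j = −5 < 0`; `∏ c_ℓ = 8`, so
`3 ∤ c₃`); the `3`-adic tower onto (`towerSurj3_v17640ce1`, Frobenius certificate); `#E(ℚ₃)[3] = 3`
(class A2, `t = 1`)) is r1's CHEAPEST depth-2 row (ROUTE-1 §35.6: `163·1567 = 255 421`, both primes
`≡ 1 (mod 27)` with `27 ∣ #Ẽ(𝔽_ℓ)` = `162`, `1512`, `Ẽ(𝔽_ℓ)[3]` cyclic) and the FIRST two-source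
depth-2 `(row, n)` (lead R5-72 ADD 2, R5-88 (a)).  EVERY curve-side input is ALREADY a kernel theorem
of the tree (n1011-p03's `towerSurj3_v17640ce1`, `tamagawaProduct_v17640ce1 = 8`,
`isKolyvaginProduct_three_v17640ce1_n255421` + `forall_card_torsion_le_v17640ce1_n255421`
(`Additive/X4ThreeKolyvaginLevelTwoCertificates1`), n1011-p17's decider `natCard_threeTorsion_v17640ce1`);
`ord₃ j < 0` by `padicValRat_j_neg_of_intModel` (`27 ∤ c₄`, `3⁷ ∣ Δ`).  This file gives:

* §1, as ONE-LINERS over n1011-p03's landed ROW SHAPE (`Additive/X4ThreeKuriharaEndM2RowShapes2`,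
  p300667; lead R5-74 (d): series / row shapes = p03 lineage, pilot = p18; nothing restated),
  **`bsdp3_endm2_v17640ce1_n255421`** (over `bsdp3_endm2_v17640ce1_of_level`: the Poitou–Tate
  family as four binders, `hEP`, mod-`9` certificate currency) and
  **`bsdp3_endm2_v17640ce1_n255421_of_facts`** (over `…_of_level_of_facts`, `hPT`); and, over this
  seat's part-5 END `Assembly.bsdp_three_potMult_of_levelTwoCertificates_of_facts_noRank_modThree_noEP`
  (p301722), **`bsdp3_endm2_v17640ce1_n255421_modThree_noEP`** — the LEANEST record: NO `hEP`, NO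
  `hr`, NO [S24], and the Kurihara VALUES in the END-m1 / ENGINE currency (`ψ` onto `ℤ/3`,
  `δ̃_{255421} ≢ 0 (mod 3)`, `δ̃_1 ≡ 0 (mod 3)`, `δ̃_1 ≢ 0 (mod 27)`; `gcd(255421, 17640) = 1` by
  `norm_num`; the row's kernel theorems fed by name exactly as in p03's row shape).  So the leanest
  END-m2 record reads: NAMED FACTS {hKatoS hDel hGZK hmod hmodD hKatoχ h26 hCT hPT} + PORT {hPort} +
  ROW (kernel) + optimal datum {D, hopt} + VALUES {hδ} — nothing else.
* §2, the SAME unit in the cell's OTHER record currency, **`bsdp3_kur_v17640ce1_n255421`** = n1011-p03's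
  [K25]-shape `bsdp3_kur_v17640ce1_of_level` (`Additive/X4ThreeKuriharaCertRecordsS2_25`, BY NAME) with
  its level slot filled by `255421 ∈ 𝒩₁` (`𝒩₃ ⊆ 𝒩₁`, `Kato.IsKolyvaginProduct.mono`) and the same
  cyclicity flag: `BSD(E,3) ∧ MissingPPartAt W 3` CONDITIONAL on `hK25s` (ANNOUNCED arXiv:2505.09121v1
  Thm. 1.1, FLAG `Kim2025-preprint`), GZK, modularity, Manin `h26`, with `hr` and the optimal datum
  displayed and ONE value `δ̃_{255421} ≢ 0 (mod 3)` — the literal 'p = 3 modulo [K25] PREPRINT'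
  reading of the word.  (p03's census-facing T-a2-REC record for this ROW stays `bsdp3_kur_v17640ce1`
  at `31·37`; this twin adds a level, not a row; no count moves.)
What a record does NOT carry, compared with the END-m1 pilot `bsdp3_endm1_v2718d1_of_facts`: `hr`,
`hEP`.  What it carries BEYOND it: the `3`-adic TOWER (a kernel theorem on this row; the END-m2
datum needs ONE `τ` at `3, 9, 27`) and a depth-2 level (`𝒩₃`).  END-m2 applies here BECAUSE `t = 1`
(END-m1's value clause is void on class A2) and `ord₃ #Ш_an = 2`.  CLOSES NOTHING beyond its
displayed binders; values = EVIDENCE; nothing booked; no class closed; no mark / label / count moved.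

References: C.-H. Kim, AJM 148 (2026) Thm. 1.9 (6), Thm. 3.13, §1.2.2, §1.4.2 [Kim2022StructureSelmer];
C.-H. Kim (app. R. Pollack), arXiv:2505.09121v1 (2025, PREPRINT) Thm. 1.1, Cor. 1.7 [Kim2025RefinedTNC];
R. Sakamoto, JTNB 36 (2024) §2, Cor. 5.5 [Sakamoto2024]; K. Rubin, PCMI 18 (2011) Thm. 2.8.4,
Cor. 2.8.9 [Rubin2011]; J. S. Milne, ADT (2006) I.2.8, I.4.10 [MilneADT2006]; A. Agashe, K. Ribet,
W. Stein, PAMQ 2 (2006) Thm. 2.6 [AgasheRibetStein2006]; J. E. Cremona, *Algorithms for Modular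
Elliptic Curves* (1997), Table 1 [CremonaAlgorithms1997]; J. H. Silverman, AEC (2009) III.2.3, VII.5,
X.4.14 [SilvermanAEC2009]; cell files cells/n1011/ROUTE-1.md §35.6/§36, PREDICTIONS-E2-AT3.md A26–A41,
`HOME/b2b-bsdres-n1011-p08/e2at3/out/{j136181,j143220}/`.
-/

set_option autoImplicit false

noncomputable section

open scoped Classical NumberField

open WeierstrassCurve Literature.NumberTheory.EllipticCurves Literature.NumberTheory.EllipticCurves.ModularForms
  Literature.NumberTheory.EllipticCurves.Rank1Residual
  Literature.NumberTheory.EllipticCurves.Rank1Residual.Typed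
  Literature.NumberTheory.EllipticCurves.AgasheRibetStein2006
  Literature.NumberTheory.GaloisRepresentations Literature.NumberTheory.GaloisCohomology
  NumberField IsDedekindDomain
  Summit.BirchSwinnertonDyer.BirchSwinnertonDyer.Rank1Residual.IntModel
  Summit.BirchSwinnertonDyer.Rank1Residual.GaloisImage
  Summit.BirchSwinnertonDyer.Rank1Residual.X4

namespace Summit.BirchSwinnertonDyer.Rank1Residual.Additive.X4ThreeKuriharaCert

/-! ### §1 The END-m2 pilot record at `(17640ce1, 255421)` (route (a′) currency: ONE port, no [S24]) -/

/-- **END-m2 PILOT RECORD (CLOSES NOTHING, moves no mark): `BSD(E,3)` for `17640ce1` at the depth-two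
level `163·1567 = 255421`, CONDITIONAL on the named UPPER facts, `hCT`, the Poitou–Tate family at `3`,
`hEP`, the ONE port at `t = 1` and the three EVIDENCE values** — n1011-p03's row shape
`bsdp3_endm2_v17640ce1_of_level` (every curve-side input a kernel theorem: `3 ∣ Δ`, `3 ∣ c₄`, the
tower `towerSurj3_v17640ce1`, `ord₃ j < 0`, `3 ∤ c₃` from `∏ c_ℓ = 8`, `#E(ℚ₃)[3] = 3`,
`N = 17640 ≤ 130000`) with its level slot FILLED by `255421 ∈ 𝒩₃` and its cyclicity flag
(`isKolyvaginProduct_three_v17640ce1_n255421`, `forall_card_torsion_le_v17640ce1_n255421`); the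
Kurihara VALUES `hδ` are EVIDENCE, a displayed certificate datum (census register word 'TWO-SOURCE
UNIT at (17640ce1, n = 255 421 = 163·1567)', census-lead GEN 16 pass 2, requests.jsonl l.2229;
sources engine 2 j136181 · ENG-D e1 j143220, module docstring): `3·δ̃_{255421}(ψ) ≠ 0` and
`3·δ̃_1 = 0` in `ℤ/9`, `δ̃_1 ≠ 0` in `ℤ/27`.  NO [S24] fact, NO `hr`.  Tier: EVIDENCE /
certificate-shaped; never a Literature fact; CERTIFICATE-EVIDENCE record SHAPE; nothing booked; no
class closed.
[cite: Kim2022StructureSelmer, Thm. 1.9 (6) and Thm. 3.13] [cite: Rubin2011, Thm. 2.8.4 and Cor. 2.8.9]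
[cite: CremonaAlgorithms1997, Table 1 (Cremona label 17640ce1)] -/
theorem bsdp3_endm2_v17640ce1_n255421
    (hKatoS : Kato2004.rankZero_padicValNat_sha_le_sub_localTamagawa_of_additive_potGood_of_imageContainsSL2)
    (hDel : Delbourgo1998.prop4_rankZero_pow_dvd_constantCoeff)
    (hGZK : rank_eq_analyticRank_of_analyticRank_le_one) (hmod : hasEntireLFunction_rat)
    (hmodD : nonempty_modularParametrizationData)
    (hKatoχ : Wuthrich2014.kato_halfEigenCharIdeal_dvd_cyclotomicPrime_of_surjective)
    (h26 : cremona_abs_maninConstant_eq_one_of_level_le)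
    (hCT : exists_casselsTate_pairing (K := ℚ))
    {W : WeierstrassCurve ℚ} [W.IsElliptic] [W.IsGloballyMinimal]
    (hI : integralModelInt W = ⟨0, 0, 0, -1242003, -532681058⟩)
    (D : ModularParametrizationData W 17640)
    (hopt : ∀ z ∈ D.L.lattice, ∃ w ∈ periodLattice D.f, z = D.c * w)
    (inv : LocalInvariants ℚ 3) (hperf : inv.IsPerfect) (hsum : inv.SumLocalTermEqZero)
    (hcompl : inv.SelmerComplement)
    (hEP : ∀ v : HeightOneSpectrum (𝓞 ℚ), localEulerPoincareCharacteristic (v.adicCompletion ℚ))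
    (v₃ : HeightOneSpectrum (𝓞 ℚ)) (hv₃ : ((3 : ℕ) : 𝓞 ℚ) ∈ v₃.asIdeal)
    (hPort : KatoKuriharaPortThreeAt W 1 v₃)
    (hδ : ∃ (ψ : (ℓ : ℕ) → (ZMod ℓ)ˣ →* Multiplicative (ZMod (3 ^ 2)))
        (ψ₂₇ : (ℓ : ℕ) → (ZMod ℓ)ˣ →* Multiplicative (ZMod (3 ^ 3))),
      (∀ ℓ ∈ (255421 : ℕ).primeFactors, Function.Surjective (ψ ℓ)) ∧
        (3 : ZMod (3 ^ 2)) * kuriharaNumber D.f (3 ^ 2) 255421 ψ ≠ 0 ∧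
        (3 : ZMod (3 ^ 2)) * kuriharaNumber D.f (3 ^ 2) 1 ψ = 0 ∧
        kuriharaNumber D.f (3 ^ 3) 1 ψ₂₇ ≠ 0) :
    haveI : Fact (Nat.Prime 3) := ⟨Nat.prime_three⟩
    BSDp W 3 :=
  haveI : NeZero (255421 : ℕ) := ⟨by norm_num⟩
  bsdp3_endm2_v17640ce1_of_level hKatoS hDel hGZK hmod hmodD hKatoχ h26 hCT hI D hopt inv hperf hsum
    hcompl hEP v₃ hv₃ hPort 255421 (isKolyvaginProduct_three_v17640ce1_n255421 hI)
    (forall_card_torsion_le_v17640ce1_n255421 hI) hδ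

/-- **END-m2 PILOT RECORD, NAMED-FACTS form (CLOSES NOTHING): `BSD(E,3)` for `17640ce1` at
`163·1567`** — n1011-p03's `bsdp3_endm2_v17640ce1_of_level_of_facts` (the Poitou–Tate family as the
named fact `hPT`) with the level slot filled by `255421`; the VALUES `hδ` = the displayed certificate
datum of the census word 'TWO-SOURCE UNIT at (17640ce1, n = 255 421 = 163·1567)' (engine 2 j136181 ·
ENG-D e1 j143220; EVIDENCE, never a Literature fact).  CERTIFICATE-EVIDENCE record SHAPE; nothing
booked; no class closed.
[cite: Kim2022StructureSelmer, Thm. 1.9 (6) and Thm. 3.13] [cite: MilneADT2006, Ch. I, Thm. 4.10]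
[cite: CremonaAlgorithms1997, Table 1 (Cremona label 17640ce1)] -/
theorem bsdp3_endm2_v17640ce1_n255421_of_facts
    (hKatoS : Kato2004.rankZero_padicValNat_sha_le_sub_localTamagawa_of_additive_potGood_of_imageContainsSL2)
    (hDel : Delbourgo1998.prop4_rankZero_pow_dvd_constantCoeff)
    (hGZK : rank_eq_analyticRank_of_analyticRank_le_one) (hmod : hasEntireLFunction_rat)
    (hmodD : nonempty_modularParametrizationData)
    (hKatoχ : Wuthrich2014.kato_halfEigenCharIdeal_dvd_cyclotomicPrime_of_surjective)
    (h26 : cremona_abs_maninConstant_eq_one_of_level_le)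
    (hCT : exists_casselsTate_pairing (K := ℚ))
    (hPT : poitouTate_selmerStructure_duality ℚ)
    {W : WeierstrassCurve ℚ} [W.IsElliptic] [W.IsGloballyMinimal]
    (hI : integralModelInt W = ⟨0, 0, 0, -1242003, -532681058⟩)
    (D : ModularParametrizationData W 17640)
    (hopt : ∀ z ∈ D.L.lattice, ∃ w ∈ periodLattice D.f, z = D.c * w)
    (hEP : ∀ v : HeightOneSpectrum (𝓞 ℚ), localEulerPoincareCharacteristic (v.adicCompletion ℚ))
    (v₃ : HeightOneSpectrum (𝓞 ℚ)) (hv₃ : ((3 : ℕ) : 𝓞 ℚ) ∈ v₃.asIdeal)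
    (hPort : KatoKuriharaPortThreeAt W 1 v₃)
    (hδ : ∃ (ψ : (ℓ : ℕ) → (ZMod ℓ)ˣ →* Multiplicative (ZMod (3 ^ 2)))
        (ψ₂₇ : (ℓ : ℕ) → (ZMod ℓ)ˣ →* Multiplicative (ZMod (3 ^ 3))),
      (∀ ℓ ∈ (255421 : ℕ).primeFactors, Function.Surjective (ψ ℓ)) ∧
        (3 : ZMod (3 ^ 2)) * kuriharaNumber D.f (3 ^ 2) 255421 ψ ≠ 0 ∧
        (3 : ZMod (3 ^ 2)) * kuriharaNumber D.f (3 ^ 2) 1 ψ = 0 ∧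
        kuriharaNumber D.f (3 ^ 3) 1 ψ₂₇ ≠ 0) :
    haveI : Fact (Nat.Prime 3) := ⟨Nat.prime_three⟩
    BSDp W 3 :=
  haveI : NeZero (255421 : ℕ) := ⟨by norm_num⟩
  bsdp3_endm2_v17640ce1_of_level_of_facts hKatoS hDel hGZK hmod hmodD hKatoχ h26 hCT hPT hI D hopt hEP
    v₃ hv₃ hPort 255421 (isKolyvaginProduct_three_v17640ce1_n255421 hI)
    (forall_card_torsion_le_v17640ce1_n255421 hI) hδ

/-- **END-m2 PILOT RECORD, LEANEST form (CLOSES NOTHING): `BSD(E,3)` for `17640ce1` at `163·1567`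
with NO `hEP` (Tate's local Euler–Poincaré characteristic = n1011-p04's theorem, p300886), NO `hr`,
NO [S24], and the Kurihara VALUES in the END-m1 / ENGINE CURRENCY** — `ψ` onto `ℤ/3` at `163`,
`1567`, `δ̃_{255421}(ψ) ≢ 0 (mod 3)` (the census word's UNIT: engine 2 j136181 `δ̃ mod 3 = 2`, ENG-D e1
j143220 `δ̃ ≡ 2 (mod 3)`), `δ̃_1 ≡ 0 (mod 3)`, `δ̃_1 ≢ 0 (mod 27)`; over this seat's
`Assembly.bsdp_three_potMult_of_levelTwoCertificates_of_facts_noRank_modThree_noEP` (the lift to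
n1011-p15's mod-`9` currency is `exists_modNine_certificate_of_modThree`; `gcd(255421, 17640) = 1` by
`norm_num`; the row's kernel theorems fed by name as in p03's row shape).  So this record reads:
NAMED FACTS {hKatoS hDel hGZK hmod hmodD hKatoχ h26 hCT hPT} + PORT {hPort} + ROW (kernel) + the
optimal datum {D, hopt} + VALUES {hδ} (EVIDENCE, never a Literature fact) — nothing else.
CERTIFICATE-EVIDENCE record SHAPE; nothing booked; no class closed.
[cite: Kim2022StructureSelmer, §1.4.3, Thm. 1.9 (6) and Thm. 3.13] [cite: MilneADT2006, Ch. I, Thm. 2.8 and Thm. 4.10]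
[cite: CremonaAlgorithms1997, Table 1 (Cremona label 17640ce1)] -/
theorem bsdp3_endm2_v17640ce1_n255421_modThree_noEP
    (hKatoS : Kato2004.rankZero_padicValNat_sha_le_sub_localTamagawa_of_additive_potGood_of_imageContainsSL2)
    (hDel : Delbourgo1998.prop4_rankZero_pow_dvd_constantCoeff)
    (hGZK : rank_eq_analyticRank_of_analyticRank_le_one) (hmod : hasEntireLFunction_rat)
    (hmodD : nonempty_modularParametrizationData)
    (hKatoχ : Wuthrich2014.kato_halfEigenCharIdeal_dvd_cyclotomicPrime_of_surjective)
    (h26 : cremona_abs_maninConstant_eq_one_of_level_le)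
    (hCT : exists_casselsTate_pairing (K := ℚ))
    (hPT : poitouTate_selmerStructure_duality ℚ)
    {W : WeierstrassCurve ℚ} [W.IsElliptic] [W.IsGloballyMinimal]
    (hI : integralModelInt W = ⟨0, 0, 0, -1242003, -532681058⟩)
    (D : ModularParametrizationData W 17640)
    (hopt : ∀ z ∈ D.L.lattice, ∃ w ∈ periodLattice D.f, z = D.c * w)
    (v₃ : HeightOneSpectrum (𝓞 ℚ)) (hv₃ : ((3 : ℕ) : 𝓞 ℚ) ∈ v₃.asIdeal)
    (hPort : KatoKuriharaPortThreeAt W 1 v₃)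
    (hδ : ∃ (ψ : (ℓ : ℕ) → (ZMod ℓ)ˣ →* Multiplicative (ZMod (3 ^ 1)))
        (ψ₂₇ : (ℓ : ℕ) → (ZMod ℓ)ˣ →* Multiplicative (ZMod (3 ^ 3))),
      (∀ ℓ ∈ (255421 : ℕ).primeFactors, Function.Surjective (ψ ℓ)) ∧
        kuriharaNumber D.f (3 ^ 1) 255421 ψ ≠ 0 ∧ kuriharaNumber D.f (3 ^ 1) 1 ψ = 0 ∧
        kuriharaNumber D.f (3 ^ 3) 1 ψ₂₇ ≠ 0) :
    haveI : Fact (Nat.Prime 3) := ⟨Nat.prime_three⟩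
    BSDp W 3 := by
  haveI : Fact (Nat.Prime 3) := ⟨Nat.prime_three⟩
  haveI : NeZero (255421 : ℕ) := ⟨by norm_num⟩
  obtain ⟨ψ, ψ₂₇, hψ, hcert, hzero₁, hunit₁⟩ := hδ
  have htam : ¬ 3 ∣ W.tamagawaProduct := by rw [tamagawaProduct_v17640ce1 hI]; decide
  have hc3 : ¬ 3 ∣ (W.baseChange ℚ_[3]).localTamagawaNumber ℤ_[3] := fun h =>
    htam (h.trans (localTamagawaNumber_padic_dvd_tamagawaProduct W 3))
  have hjneg : padicValRat 3 W.j < 0 :=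
    padicValRat_j_neg_of_intModel hI 3 2 (by decide +kernel) (by decide +kernel)
  exact Assembly.bsdp_three_potMult_of_levelTwoCertificates_of_facts_noRank_modThree_noEP hKatoS hDel
    hGZK hmod hmodD hKatoχ h26 hCT hPT W hI (by decide +kernel) (by decide +kernel)
    (towerSurj3_v17640ce1 hI) hjneg hc3 (natCard_threeTorsion_v17640ce1 W hI) (by norm_num) D hopt v₃
    hv₃ hPort 255421 (isKolyvaginProduct_three_v17640ce1_n255421 hI) (by norm_num)
    (forall_card_torsion_le_v17640ce1_n255421 hI) ψ hψ hcert hzero₁ ψ₂₇ hunit₁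

/-! ### §2 The same two-source unit in the [K25] currency (`hK25s`, FLAG `Kim2025-preprint`) -/

/-- **The census word's unit in the cell's [K25] record currency (CLOSES NOTHING, moves no mark):
`BSD(E,3) ∧ MissingPPartAt W 3` for `17640ce1` at `163·1567 = 255421`, CONDITIONAL on the ANNOUNCED
[K25] Thm. 1.1 clause `hK25s`** (FLAG `Kim2025-preprint`; arXiv:2505.09121v1 is the reason, not a
source of truth), GZK, modularity and Manin (`h26`), with `hr` (Cremona: `r_an = 0`) and the optimal
datum (`D`, `hopt`) displayed and ONE value — `δ̃_{255421}(ψ) ≢ 0 (mod 3)` for `ψ` onto `ℤ/3` at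
`163`, `1567` = the displayed certificate datum `hδ` of the census register word 'TWO-SOURCE UNIT at
(17640ce1, n = 255 421 = 163·1567)' (census-lead GEN 16 pass 2, requests.jsonl l.2229; engine 2
j136181 `δ̃ mod 3 = 2` · ENG-D e1 j143220 `δ̃ ≡ 2 (mod 3)`; tier EVIDENCE / certificate-shaped, never
a Literature fact; 'p = 3 modulo [K25] PREPRINT') — n1011-p03's `bsdp3_kur_v17640ce1_of_level` BY
NAME (surj(3) and the tower, `Addv`, `3 ∤ ∏ c_ℓ = 8`, `N ≤ 130000`, `Ω⁺_f`-integrality all inside it)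
with the level slot filled by `255421 ∈ 𝒩₁(E,3)` (`𝒩₃ ⊆ 𝒩₁`, Kim §1.4.2, from
`isKolyvaginProduct_three_v17640ce1_n255421`) and the cyclicity flag
`forall_card_torsion_le_v17640ce1_n255421`.  p03's T-a2-REC record of this ROW stays
`bsdp3_kur_v17640ce1` (`31·37`); this adds a LEVEL, not a row; no census count moves.
[claim: Kim2025RefinedTNC, status: under-review]
[cite: Kim2025RefinedTNC, Thm. 1.1 ("BSD"), Cor. 1.7 (ANNOUNCED preprint — the reason, not a source of truth)]
[cite: Kim2022StructureSelmer, §1.2.2, §1.4.2 and Thm. 1.10 (1)] [cite: AgasheRibetStein2006, Thm. 2.6 (p. 619)]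
[cite: CremonaAlgorithms1997, Table 1 (Cremona label 17640ce1)] -/
theorem bsdp3_kur_v17640ce1_n255421
    (hK25s : Kim2025.thm11_kimShaLength_of_integralPeriod_OPEN)
    (hGZK : rank_eq_analyticRank_of_analyticRank_le_one) (hmod : hasEntireLFunction_rat)
    (h26 : cremona_abs_maninConstant_eq_one_of_level_le)
    {W : WeierstrassCurve ℚ} [W.IsElliptic] [W.IsGloballyMinimal]
    (hI : integralModelInt W = ⟨0, 0, 0, -1242003, -532681058⟩)
    (hr : W.analyticRank = 0)
    (D : ModularParametrizationData W 17640)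
    (hopt : ∀ z ∈ D.L.lattice, ∃ w ∈ periodLattice D.f, z = D.c * w)
    (hδ : ∃ ψ : (ℓ : ℕ) → (ZMod ℓ)ˣ →* Multiplicative (ZMod (3 ^ 1)),
      (∀ ℓ ∈ (255421 : ℕ).primeFactors, Function.Surjective (ψ ℓ)) ∧
        kuriharaNumber D.f (3 ^ 1) 255421 ψ ≠ 0) :
    haveI : Fact (Nat.Prime 3) := ⟨Nat.prime_three⟩
    BSDp W 3 ∧ MissingPPartAt W 3 := by
  haveI : Fact (Nat.Prime 3) := ⟨Nat.prime_three⟩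
  haveI : NeZero (255421 : ℕ) := ⟨by norm_num⟩
  have hn : Kato.IsKolyvaginProduct W 3 1 255421 :=
    (isKolyvaginProduct_three_v17640ce1_n255421 hI).mono (by norm_num)
  exact bsdp3_kur_v17640ce1_of_level hK25s hGZK hmod h26 hI hr D hopt 255421 hn
    (forall_card_torsion_le_v17640ce1_n255421 hI) hδ

end Summit.BirchSwinnertonDyer.Rank1Residual.Additive.X4ThreeKuriharaCert

end
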